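import Literature.Analysis.FluidPDE.HouLiAxisModel
import HarnessLib

/-!
# Hou–Li 2008 §3.1: the ODE model — Theorem 2 (explicit solution, global existence, decay), proved

Analysis/FluidPDE proof file (no definitions, no named facts, no `sorry`), companion of
`HouLiAxisModel.lean` (T. Y. Hou, C. Li, *Dynamic stability of the three-dimensional axisymmetric
Navier–Stokes equations with swirl*, Comm. Pure Appl. Math. 61 (2008) 661–697). §3.1 (p. 7):
"To start with, we consider an ODE model by ignoring the convection and diffusion terms.
(33) `ũₜ = −2ṽũ`, (34) `ṽₜ = ũ² − ṽ²`, with initial condition `ũ(0) = ũ₀` and `ṽ(0) = ṽ₀`.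
Clearly, if `ũ₀ = 0`, then `ũ(t) = 0` for all `t > 0`. In this case, the equation for `ṽ` is
decoupled from `ũ` completely, and will blow up in finite time if `ṽ₀ < 0`." and (p. 8)

> **Theorem 2.** Assume that `ũ₀ ≠ 0`. Then the solution `(ũ(t), ṽ(t))` of the ODE system
> (33)–(34) exists for all times. Moreover, we have `lim_{t→+∞} ũ(t) = 0`, `lim_{t→+∞} ṽ(t) = 0`. (35)
> *Proof.* … Let `w = ũ + iṽ`. Then the ODE system (33)–(34) is reduced to the complex nonlinear
> ODE (36) `dw/dt = iw²`, `w(0) = w₀`, which can be solved analytically. The solution has the form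
> (37) `w(t) = w₀/(1 − iw₀t)`. In terms of the original variables, we have
> (38) `ũ(t) = ũ₀ / ((1 + ṽ₀t)² + (ũ₀t)²)`, (39) `ṽ(t) = (ṽ₀(1 + ṽ₀t) + ũ₀²t) / ((1 + ṽ₀t)² + (ũ₀t)²)`.
> It is clear from (38)–(39) that the solution of the ODE system (33)–(34) exists for all times
> and decays to zero as `t → +∞` as long as `ũ₀ ≠ 0`.

This file PROVES, with the explicit pair (38)–(39) written out:

* `HouLiODEModel.denom_pos` — `(1 + ṽ₀t)² + (ũ₀t)² > 0` for all real `t` when `ũ₀ ≠ 0` (so (38)–(39)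
  are defined for all times);
* `HouLiODEModel.explicit_initial` — the pair (38)–(39) takes the data `(ũ₀, ṽ₀)` at `t = 0`;
* `HouLiODEModel.hasDerivAt_explicit_u` / `hasDerivAt_explicit_v` — it solves (33)–(34) at every
  real `t` (Theorem 2, existence for all times, by the printed formula);
* `HouLiODEModel.sq_add_sq_explicit` — the modulus identity behind (37):
  `ũ(t)² + ṽ(t)² = (ũ₀² + ṽ₀²) / ((1 + ṽ₀t)² + (ũ₀t)²)` (`|w(t)|² = |w₀|²/|1 − iw₀t|²`);
* `HouLiODEModel.tendsto_explicit_u` / `tendsto_explicit_v` — (35): both components tend to `0` as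
  `t → +∞`;
* `HouLiODEModel.hasDerivAt_blowup_v` / `tendsto_blowup_v_atBot` — the printed contrast for
  `ũ₀ = 0`, `ṽ₀ < 0`: `ũ ≡ 0`, `ṽ(t) = ṽ₀/(1 + ṽ₀t)` solves (34) and tends to `−∞` as
  `t ↑ −1/ṽ₀` (finite-time blow-up without the `ũ`-coupling);
* `HouLiODEModel.hasDerivAt_selfSimilar_u` / `_v` / `tendsto_abs_selfSimilar_u_atTop` — the
  generalized system (40)–(41) `ũₜ = −dṽũ`, `ṽₜ = ũ² − ṽ²`: for `d < 1` (`d ≠ 0`) the explicit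
  self-similar pair `ũ = ±√(1 − d)/(d(T − t))`, `ṽ = −1/(d(T − t))` solves it and blows up at `T`
  (the printed claim of Remark 2, p. 9, "if `d < 1`, it is possible to construct a family of
  solutions … which blow up in a finite time", made explicit; Theorem A — `d ≥ 1` global — is not
  restated here).

Uniqueness of the solution of (33)–(34) (a smooth, hence locally Lipschitz, planar vector field)
is standard Picard–Lindelöf and is not restated. WHAT THIS IS NOT: not Navier–Stokes and not the
axis model (22)–(24) — it is Hou–Li's zero-dimensional caricature "ignoring the convection and
diffusion terms", the ODE level of the mechanism "the coefficient `2 ≥ 1` in (33) stabilises"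
(Remark 2 and (40)–(41), Appendix A: `d ≥ 1` global, `d < 1` admits finite-time blow-up), the
shadow of SELFSIM-NOGO (M10)'s clause "its blow-ups need the advection weakened". MODEL.

## References

* T. Y. Hou, C. Li, Comm. Pure Appl. Math. 61 (2008) 661–697, doi:10.1002/cpa.20212: §3.1,
  (33)–(39), Thm. 2, Remarks 1–2, pp. 7–9 of the 32-page version (held text
  `paper:doi-10-1002-cpa-20212`, p0007–p0009). [`HouLi2007`]
-/

noncomputable section

open Set Filter Topology

namespace Literature.Analysis.FluidPDE

namespace HouLiODEModel

/-- The common denominator `(1 + ṽ₀t)² + (ũ₀t)²` of (38)–(39) is positive for every real `t` when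
`ũ₀ ≠ 0` ("exists for all times … as long as `ũ₀ ≠ 0`"). [cite: HouLi2007, Thm. 2 proof, (38)–(39) (p. 8)] -/
theorem denom_pos {u₀ : ℝ} (hu₀ : u₀ ≠ 0) (v₀ t : ℝ) : 0 < (1 + v₀ * t) ^ 2 + (u₀ * t) ^ 2 := by
  rcases eq_or_ne t 0 with rfl | ht
  · norm_num
  · have h : 0 < (u₀ * t) ^ 2 := by
      rw [sq]
      exact mul_self_pos.2 (mul_ne_zero hu₀ ht)
    nlinarith [sq_nonneg (1 + v₀ * t)]

/-- The explicit pair (38)–(39) takes the initial values `(ũ₀, ṽ₀)` at `t = 0`.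
[cite: HouLi2007, (33)–(34) with data, (38)–(39) (pp. 7–8)] -/
theorem explicit_initial (u₀ v₀ : ℝ) :
    u₀ / ((1 + v₀ * 0) ^ 2 + (u₀ * 0) ^ 2) = u₀ ∧
      (v₀ * (1 + v₀ * 0) + u₀ ^ 2 * 0) / ((1 + v₀ * 0) ^ 2 + (u₀ * 0) ^ 2) = v₀ := by
  constructor <;> norm_num

/-- **Theorem 2, equation (33)**: the explicit `ũ` of (38) satisfies `ũₜ = −2ṽũ` with the explicit `ṽ`
of (39), at every real `t` (`ũ₀ ≠ 0`). [cite: HouLi2007, Thm. 2, (33), (38)–(39) (pp. 7–8)] -/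
theorem hasDerivAt_explicit_u {u₀ : ℝ} (hu₀ : u₀ ≠ 0) (v₀ t : ℝ) :
    HasDerivAt (fun s : ℝ => u₀ / ((1 + v₀ * s) ^ 2 + (u₀ * s) ^ 2))
      (-2 * ((v₀ * (1 + v₀ * t) + u₀ ^ 2 * t) / ((1 + v₀ * t) ^ 2 + (u₀ * t) ^ 2)) *
        (u₀ / ((1 + v₀ * t) ^ 2 + (u₀ * t) ^ 2))) t := by
  have hD := denom_pos hu₀ v₀ t
  have hD' : HasDerivAt (fun s : ℝ => (1 + v₀ * s) ^ 2 + (u₀ * s) ^ 2)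
      (2 * (1 + v₀ * t) * v₀ + 2 * (u₀ * t) * u₀) t := by
    have h1 := (((hasDerivAt_id t).const_mul v₀).const_add 1).pow 2
    have h2 := ((hasDerivAt_id t).const_mul u₀).pow 2
    have h := h1.add h2
    refine h.congr_deriv ?_
    simp only [id, Nat.cast_ofNat, mul_one]
    ring
  have h := (hasDerivAt_const t u₀).div hD' hD.ne'
  refine h.congr_deriv ?_
  field_simp
  ring

/-- **Theorem 2, equation (34)**: the explicit `ṽ` of (39) satisfies `ṽₜ = ũ² − ṽ²` with the explicit
`ũ` of (38), at every real `t` (`ũ₀ ≠ 0`). [cite: HouLi2007, Thm. 2, (34), (38)–(39) (pp. 7–8)] -/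
theorem hasDerivAt_explicit_v {u₀ : ℝ} (hu₀ : u₀ ≠ 0) (v₀ t : ℝ) :
    HasDerivAt (fun s : ℝ => (v₀ * (1 + v₀ * s) + u₀ ^ 2 * s) / ((1 + v₀ * s) ^ 2 + (u₀ * s) ^ 2))
      ((u₀ / ((1 + v₀ * t) ^ 2 + (u₀ * t) ^ 2)) ^ 2 -
        ((v₀ * (1 + v₀ * t) + u₀ ^ 2 * t) / ((1 + v₀ * t) ^ 2 + (u₀ * t) ^ 2)) ^ 2) t := by
  have hD := denom_pos hu₀ v₀ t
  have hD' : HasDerivAt (fun s : ℝ => (1 + v₀ * s) ^ 2 + (u₀ * s) ^ 2)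
      (2 * (1 + v₀ * t) * v₀ + 2 * (u₀ * t) * u₀) t := by
    have h1 := (((hasDerivAt_id t).const_mul v₀).const_add 1).pow 2
    have h2 := ((hasDerivAt_id t).const_mul u₀).pow 2
    have h := h1.add h2
    refine h.congr_deriv ?_
    simp only [id, Nat.cast_ofNat, mul_one]
    ring
  have hN' : HasDerivAt (fun s : ℝ => v₀ * (1 + v₀ * s) + u₀ ^ 2 * s) (v₀ * v₀ + u₀ ^ 2) t := by
    have h1 := (((hasDerivAt_id t).const_mul v₀).const_add 1).const_mul v₀
    have h2 := (hasDerivAt_id t).const_mul (u₀ ^ 2)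
    have h := h1.add h2
    refine h.congr_deriv ?_
    simp only [mul_one]
  have h := hN'.div hD' hD.ne'
  refine h.congr_deriv ?_
  field_simp
  ring

/-- The modulus identity behind (37) (`|w(t)|² = |w₀|² / |1 − iw₀t|²`): for the explicit pair
(38)–(39), `ũ(t)² + ṽ(t)² = (ũ₀² + ṽ₀²) / ((1 + ṽ₀t)² + (ũ₀t)²)`.
[cite: HouLi2007, Thm. 2 proof, (36)–(39) (p. 8)] -/
theorem sq_add_sq_explicit {u₀ : ℝ} (hu₀ : u₀ ≠ 0) (v₀ t : ℝ) :
    (u₀ / ((1 + v₀ * t) ^ 2 + (u₀ * t) ^ 2)) ^ 2 +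
        ((v₀ * (1 + v₀ * t) + u₀ ^ 2 * t) / ((1 + v₀ * t) ^ 2 + (u₀ * t) ^ 2)) ^ 2 =
      (u₀ ^ 2 + v₀ ^ 2) / ((1 + v₀ * t) ^ 2 + (u₀ * t) ^ 2) := by
  have hD := denom_pos hu₀ v₀ t
  rw [div_pow, div_pow, ← add_div, div_eq_div_iff (pow_ne_zero 2 hD.ne') hD.ne']
  ring

/-- The denominator of (38)–(39) tends to `+∞`: `(1 + ṽ₀t)² + (ũ₀t)² ≥ ũ₀²t² → ∞` (`ũ₀ ≠ 0`).
[cite: HouLi2007, Thm. 2 proof, "decays to zero as `t → +∞`" (p. 8)] -/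
theorem tendsto_denom_atTop {u₀ : ℝ} (hu₀ : u₀ ≠ 0) (v₀ : ℝ) :
    Tendsto (fun t : ℝ => (1 + v₀ * t) ^ 2 + (u₀ * t) ^ 2) atTop atTop := by
  have hu2 : 0 < u₀ ^ 2 := by positivity
  have h1 : Tendsto (fun t : ℝ => u₀ ^ 2 * t ^ 2) atTop atTop :=
    (tendsto_pow_atTop two_ne_zero).const_mul_atTop hu2
  refine tendsto_atTop_mono (fun t => ?_) h1
  nlinarith [sq_nonneg (1 + v₀ * t)]

/-- **Theorem 2, (35), first limit**: `lim_{t→+∞} ũ(t) = 0` for the explicit solution (38)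
(`ũ₀ ≠ 0`). [cite: HouLi2007, Thm. 2, (35) (p. 8)] -/
theorem tendsto_explicit_u {u₀ : ℝ} (hu₀ : u₀ ≠ 0) (v₀ : ℝ) :
    Tendsto (fun t : ℝ => u₀ / ((1 + v₀ * t) ^ 2 + (u₀ * t) ^ 2)) atTop (𝓝 0) :=
  tendsto_const_nhds.div_atTop (tendsto_denom_atTop hu₀ v₀)

/-- **Theorem 2, (35), second limit**: `lim_{t→+∞} ṽ(t) = 0` for the explicit solution (39)
(`ũ₀ ≠ 0`): for `t > 0`, `ṽ(t) = (ṽ₀/t + (ṽ₀² + ũ₀²)) / (D(t)/t)` with `D(t)/t ≥ ũ₀²t → ∞`.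
[cite: HouLi2007, Thm. 2, (35) (p. 8)] -/
theorem tendsto_explicit_v {u₀ : ℝ} (hu₀ : u₀ ≠ 0) (v₀ : ℝ) :
    Tendsto (fun t : ℝ => (v₀ * (1 + v₀ * t) + u₀ ^ 2 * t) / ((1 + v₀ * t) ^ 2 + (u₀ * t) ^ 2))
      atTop (𝓝 0) := by
  have hu2 : 0 < u₀ ^ 2 := by positivity
  -- numerator / t → ṽ₀² + ũ₀², denominator / t → ∞
  have hN : Tendsto (fun t : ℝ => v₀ / t + (v₀ * v₀ + u₀ ^ 2)) atTop (𝓝 (0 + (v₀ * v₀ + u₀ ^ 2))) :=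
    (tendsto_const_nhds.div_atTop tendsto_id).add tendsto_const_nhds
  have hD : Tendsto (fun t : ℝ => ((1 + v₀ * t) ^ 2 + (u₀ * t) ^ 2) / t) atTop atTop := by
    have h1 : Tendsto (fun t : ℝ => u₀ ^ 2 * t) atTop atTop := tendsto_id.const_mul_atTop hu2
    refine tendsto_atTop_mono' atTop ?_ h1
    filter_upwards [eventually_gt_atTop (0 : ℝ)] with t ht
    rw [le_div_iff₀ ht]
    nlinarith [sq_nonneg (1 + v₀ * t)]
  have h := hN.div_atTop hD
  refine h.congr' ?_
  filter_upwards [eventually_gt_atTop (0 : ℝ)] with t ht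
  have hDt := (denom_pos hu₀ v₀ t).ne'
  field_simp
  ring

/-- **The contrast for `ũ₀ = 0`** (p. 7: "if `ũ₀ = 0`, then `ũ(t) = 0` for all `t > 0` … the equation
for `ṽ` is decoupled from `ũ` completely, and will blow up in finite time if `ṽ₀ < 0`"): with `ũ ≡ 0`,
(33) holds trivially and `ṽ(t) = ṽ₀/(1 + ṽ₀t)` solves (34), `ṽₜ = 0² − ṽ²`, wherever `1 + ṽ₀t ≠ 0`.
[cite: HouLi2007, §3.1 (p. 7)] -/
theorem hasDerivAt_blowup_v (v₀ t : ℝ) (ht : 1 + v₀ * t ≠ 0) :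
    HasDerivAt (fun s : ℝ => v₀ / (1 + v₀ * s))
      ((0 : ℝ) ^ 2 - (v₀ / (1 + v₀ * t)) ^ 2) t := by
  have hD' : HasDerivAt (fun s : ℝ => 1 + v₀ * s) (v₀ * 1) t :=
    ((hasDerivAt_id' t).const_mul v₀).const_add 1
  have h := (hasDerivAt_const t v₀).div hD' ht
  refine h.congr_deriv ?_
  field_simp
  ring

/-- **Finite-time blow-up for `ũ₀ = 0`, `ṽ₀ < 0`**: `ṽ(t) = ṽ₀/(1 + ṽ₀t) → −∞` as `t ↑ T* = −1/ṽ₀`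
(the blow-up that the `ũ`-coupling of Theorem 2 prevents). [cite: HouLi2007, §3.1 (p. 7); Remark 2 (p. 9)] -/
theorem tendsto_blowup_v_atBot {v₀ : ℝ} (hv₀ : v₀ < 0) :
    Tendsto (fun t : ℝ => v₀ / (1 + v₀ * t)) (𝓝[<] (-1 / v₀)) atBot := by
  -- `1 + ṽ₀ t → 0⁺` as `t ↑ −1/ṽ₀`
  have h1 : Tendsto (fun t : ℝ => 1 + v₀ * t) (𝓝[<] (-1 / v₀)) (𝓝[>] 0) := by
    have hc : Tendsto (fun t : ℝ => 1 + v₀ * t) (𝓝 (-1 / v₀)) (𝓝 (1 + v₀ * (-1 / v₀))) :=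
      ((continuous_const.add (continuous_const.mul continuous_id)).tendsto _)
    have hv : v₀ ≠ 0 := hv₀.ne
    have e : 1 + v₀ * (-1 / v₀) = 0 := by field_simp; ring
    rw [e] at hc
    refine tendsto_nhdsWithin_iff.2 ⟨hc.mono_left nhdsWithin_le_nhds, ?_⟩
    filter_upwards [self_mem_nhdsWithin] with t ht
    have ht' : t < -1 / v₀ := ht
    show 0 < 1 + v₀ * t
    have : v₀ * (-1 / v₀) < v₀ * t := mul_lt_mul_of_neg_left ht' hv₀
    linarith [this, e]
  have h2 : Tendsto (fun t : ℝ => (1 + v₀ * t)⁻¹) (𝓝[<] (-1 / v₀)) atTop :=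
    tendsto_inv_nhdsGT_zero.comp h1
  have h3 := h2.const_mul_atTop_of_neg hv₀
  refine h3.congr fun t => ?_
  simp [div_eq_mul_inv]

/-! ### The generalized system (40)–(41), `ũₜ = −dṽũ`, `ṽₜ = ũ² − ṽ²`: blow-up for `d < 1`

Printed (Remark 2, p. 9): "The key ingredient in obtaining the global existence in Theorem 2 is
that the coefficient on the right hand side of (33) is less than `−1`. … In Appendix A, we prove the
same result for a more general ODE system of the following form: (40) `ũₜ = −dṽũ`,
(41) `ṽₜ = ũ² − ṽ²`, for any constant `d ≥ 1` [Theorem A, p. 28]. However, if `d < 1`, it is possible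
to construct a family of solutions for the ODE systems (40)–(41) which blow up in a finite time."
The paper does not print the family; the explicit SELF-SIMILAR one below (ansatz `ũ = α/(T − t)`,
`ṽ = β/(T − t)` forces `β = −1/d`, `α² = (1 − d)/d²`, real and nonzero exactly when `d < 1`, `d ≠ 0`)
realises the printed claim in the kernel. -/

/-- **Weak coupling `d < 1` blows up — equation (40)**: for `d < 1`, `d ≠ 0`, any blow-up time `T`
and either sign `σ = ±1`, the self-similar pair `ũ(t) = σ√(1 − d)/(d(T − t))`, `ṽ(t) = −1/(d(T − t))`
satisfies `ũₜ = −dṽũ` at every `t ≠ T`. [cite: HouLi2007, Remark 2 with (40)–(41) (p. 9): "if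
`d < 1`, it is possible to construct a family of solutions … which blow up in a finite time"; the
explicit family is supplied here] -/
theorem hasDerivAt_selfSimilar_u {d σ : ℝ} (hd0 : d ≠ 0) (T t : ℝ) (ht : t ≠ T) :
    HasDerivAt (fun s : ℝ => σ * Real.sqrt (1 - d) / d / (T - s))
      (-d * (-1 / d / (T - t)) * (σ * Real.sqrt (1 - d) / d / (T - t))) t := by
  have hTt : T - t ≠ 0 := sub_ne_zero.2 (Ne.symm ht)
  have hD' : HasDerivAt (fun s : ℝ => T - s) (0 - 1) t :=
    (hasDerivAt_const t T).sub (hasDerivAt_id' t)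
  have h := (hasDerivAt_const t (σ * Real.sqrt (1 - d) / d)).div hD' hTt
  refine h.congr_deriv ?_
  field_simp
  ring

/-- **Weak coupling `d < 1` blows up — equation (41)**: for `d < 1`, `d ≠ 0`, `σ = ±1`, the same pair
satisfies `ṽₜ = ũ² − ṽ²` at every `t ≠ T` (here `σ² = 1` and `(√(1 − d))² = 1 − d` are used: the
ansatz closes exactly because `α² − β² = (1 − d)/d² − 1/d² = −1/d = β`).
[cite: HouLi2007, Remark 2 with (40)–(41) (p. 9); explicit family supplied here] -/
theorem hasDerivAt_selfSimilar_v {d σ : ℝ} (hd0 : d ≠ 0) (hd : d < 1) (hσ : σ = 1 ∨ σ = -1)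
    (T t : ℝ) (ht : t ≠ T) :
    HasDerivAt (fun s : ℝ => -1 / d / (T - s))
      ((σ * Real.sqrt (1 - d) / d / (T - t)) ^ 2 - (-1 / d / (T - t)) ^ 2) t := by
  have hTt : T - t ≠ 0 := sub_ne_zero.2 (Ne.symm ht)
  have hσ2 : σ ^ 2 = 1 := by rcases hσ with rfl | rfl <;> norm_num
  have hs : Real.sqrt (1 - d) ^ 2 = 1 - d := Real.sq_sqrt (by linarith)
  have hD' : HasDerivAt (fun s : ℝ => T - s) (0 - 1) t :=
    (hasDerivAt_const t T).sub (hasDerivAt_id' t)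
  have h := (hasDerivAt_const t (-1 / d)).div hD' hTt
  refine h.congr_deriv ?_
  simp only [div_pow, mul_pow, hσ2, hs, one_mul]
  field_simp
  ring

/-- **The `d < 1` family blows up at `t = T`**: `|ũ(t)| = √(1 − d)/(|d|(T − t)) → +∞` as `t ↑ T`
(`d < 1`, `d ≠ 0`, `σ = ±1`). [cite: HouLi2007, Remark 2 (p. 9); explicit family supplied here] -/
theorem tendsto_abs_selfSimilar_u_atTop {d σ : ℝ} (hd0 : d ≠ 0) (hd : d < 1) (hσ : σ = 1 ∨ σ = -1)
    (T : ℝ) :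
    Tendsto (fun t : ℝ => |σ * Real.sqrt (1 - d) / d / (T - t)|) (𝓝[<] T) atTop := by
  have hσabs : |σ| = 1 := by rcases hσ with rfl | rfl <;> norm_num
  have hsqrt : 0 < Real.sqrt (1 - d) := Real.sqrt_pos.2 (by linarith)
  have hc : 0 < Real.sqrt (1 - d) / |d| := div_pos hsqrt (abs_pos.2 hd0)
  -- `T − t → 0⁺` as `t ↑ T`
  have h1 : Tendsto (fun t : ℝ => T - t) (𝓝[<] T) (𝓝[>] 0) := by
    have hc' : Tendsto (fun t : ℝ => T - t) (𝓝 T) (𝓝 (T - T)) :=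
      (continuous_const.sub continuous_id).tendsto _
    rw [sub_self] at hc'
    refine tendsto_nhdsWithin_iff.2 ⟨hc'.mono_left nhdsWithin_le_nhds, ?_⟩
    filter_upwards [self_mem_nhdsWithin] with t ht
    have ht' : t < T := ht
    show 0 < T - t
    linarith
  have h2 : Tendsto (fun t : ℝ => (T - t)⁻¹) (𝓝[<] T) atTop := tendsto_inv_nhdsGT_zero.comp h1
  have h3 := h2.const_mul_atTop hc
  refine h3.congr' ?_
  filter_upwards [self_mem_nhdsWithin] with t ht
  have ht' : t < T := ht
  have hTt : 0 < T - t := by linarith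
  rw [abs_div, abs_div, abs_mul, hσabs, one_mul, abs_of_pos hsqrt, abs_of_pos hTt]
  ring

end HouLiODEModel

end Literature.Analysis.FluidPDE

end
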